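import Mathlib

/-!
# Crux `SkeletonJ1R` (stmt-NavierStokesRegularity-23610) · strategist r1-g3 · idea `logxi-escape-confinement`

First lemma of the idea (lens: transfer — positive-commutator / radial-point technology for the switched linearised
normal operator of line `switchoff_degree_R`, stub `stub_confinement`).

The switched linearised normal operator along an arm is, near the waist `τ = 0` and at high frequency,
the Fuchsian system `−(a·t)·Y′(t) + B·Y(t) = f(t)` with `a = w′(0) > 0` (switched slip slope) and `B` the waist
normal block (`σ(S⊥ + 2ΩJ) − (1−σ)λ·Id`, Hurwitz: trace `< 0`, determinant `> 0`, i.e. `β`-dissipative in a Lyapunov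
inner product).  `WaistSinkBound` is the quantitative, forced, vector-valued "above-threshold radial-sink" estimate:
every solution that stays BOUNDED as `t → 0⁺` obeys `‖Y t‖ ≤ L/β` (`L = sup ‖f‖`), with NO boundary datum — hence the
bounded (a fortiori `C²`) solution is unique (`f = 0 ⇒ Y = 0`).  Proof sketch (not carried out here; planners do not
prove): `n = ‖Y‖²` satisfies `n′ ≤ (2/(a t))(−β‖Y‖² + L‖Y‖)`; if `‖Y t₀‖ > L/β` then `n` increases at least like
`κ·log(t₀/t)` as `t ↓ 0`, contradicting boundedness.  (The tree's `stub_coreAreaFuchsianRigidity` is the scalar,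
homogeneous, qualitative shadow of this statement; the present one is the estimate the confinement bootstrap consumes.)
-/

set_option linter.dupNamespace false

namespace Summit.NavierStokesRegularity.NavierStokesRegularity.Cruxes.SkeletonJ1R.LogxiEscape

open scoped InnerProductSpace

/-- FIRST LEMMA (idea `logxi-escape-confinement`) · the waist radial-sink bound.  In the normal plane
`E = EuclideanSpace ℝ (Fin 2)`: for `a, β > 0`, a `β`-dissipative block `B`, a forcing `f` with `‖f‖ ≤ L` on `(0, T]`,
every solution of `−(a t) Y′ + B Y = f` on `(0, T]` that is bounded on `(0, T]` satisfies `‖Y t‖ ≤ L / β` there. -/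
def WaistSinkBound : Prop :=
  ∀ (a β T L : ℝ) (B : EuclideanSpace ℝ (Fin 2) →L[ℝ] EuclideanSpace ℝ (Fin 2))
    (Y f : ℝ → EuclideanSpace ℝ (Fin 2)),
    0 < a → 0 < β → 0 < T → 0 ≤ L →
    (∀ y : EuclideanSpace ℝ (Fin 2), ⟪B y, y⟫_ℝ ≤ -β * ‖y‖ ^ 2) →
    (∀ t ∈ Set.Ioc (0:ℝ) T, HasDerivAt Y (deriv Y t) t) →
    (∀ t ∈ Set.Ioc (0:ℝ) T, -(a * t) • deriv Y t + B (Y t) = f t) →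
    (∀ t ∈ Set.Ioc (0:ℝ) T, ‖f t‖ ≤ L) →
    BddAbove ((fun t => ‖Y t‖) '' Set.Ioc (0:ℝ) T) →
    ∀ t ∈ Set.Ioc (0:ℝ) T, ‖Y t‖ ≤ L / β

/-- COROLLARY shape (uniqueness of the bounded waist solution): the homogeneous case of `WaistSinkBound`. -/
def WaistSinkUnique : Prop :=
  ∀ (a β T : ℝ) (B : EuclideanSpace ℝ (Fin 2) →L[ℝ] EuclideanSpace ℝ (Fin 2)) (Y : ℝ → EuclideanSpace ℝ (Fin 2)),
    0 < a → 0 < β → 0 < T →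
    (∀ y : EuclideanSpace ℝ (Fin 2), ⟪B y, y⟫_ℝ ≤ -β * ‖y‖ ^ 2) →
    (∀ t ∈ Set.Ioc (0:ℝ) T, HasDerivAt Y (deriv Y t) t) →
    (∀ t ∈ Set.Ioc (0:ℝ) T, -(a * t) • deriv Y t + B (Y t) = 0) →
    BddAbove ((fun t => ‖Y t‖) '' Set.Ioc (0:ℝ) T) →
    ∀ t ∈ Set.Ioc (0:ℝ) T, Y t = 0

/-- The corollary follows from the bound with `f = 0`, `L = 0` (checked glue, no `sorry`). -/
theorem waistSinkUnique_of_bound (h : WaistSinkBound) : WaistSinkUnique := by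
  intro a β T B Y ha hβ hT hB hY hODE hbdd t ht
  have key := h a β T 0 B Y (fun _ => 0) ha hβ hT le_rfl hB hY
    (by intro s hs; simpa using hODE s hs) (by intro s hs; simp) hbdd t ht
  have : ‖Y t‖ ≤ 0 := by simpa using key
  exact norm_le_zero_iff.mp this

/-- THE ESCAPE IDENTITY behind the idea (symbol level, pure calculus): for the scalar principal symbol
`p(τ, ξ) = S(τ)·m(ξ) − w(τ)·ξ` of the switched operator and the frequency-dilation escape function `q(ξ) = log ξ`
(`ξ > 0`), the Poisson bracket `{p, q} = ∂_ξ p · ∂_τ q − ∂_τ p · ∂_ξ q = −∂_τ p / ξ` equals `w′(τ) − S′(τ)·m(ξ)/ξ`,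
and ON THE CHARACTERISTIC SET `p = 0` with `S(τ) ≠ 0` it equals `w′(τ) − w(τ)·S′(τ)/S(τ)`: positive wherever the
slip is stretching (`w′ > 0`) and the self-induction weight decreases away from the waist (`−w·S′/S ≥ 0`). -/
theorem escape_identity (S m w : ℝ → ℝ) (S' m' w' : ℝ) (τ ξ : ℝ) (hξ : ξ ≠ 0) (hS : S τ ≠ 0)
    (_hSd : HasDerivAt S S' τ) (_hwd : HasDerivAt w w' τ) (_hmd : HasDerivAt m m' ξ)
    (hchar : S τ * m ξ - w τ * ξ = 0) :
    -- {p,q} with q = log|ξ|:  (∂_ξ p)·0 − (∂_τ p)·(1/ξ)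
    -((S' * m ξ - w' * ξ) * (1 / ξ)) = w' - w τ * S' / S τ := by
  have hm : m ξ = w τ * ξ / S τ := by
    field_simp
    linarith [hchar]
  rw [hm]
  field_simp
  ring

end Summit.NavierStokesRegularity.NavierStokesRegularity.Cruxes.SkeletonJ1R.LogxiEscape
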